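import Summits.ABC.IUTFork.Repair.CandExplicit10
import Summits.ABC.IUTFork.Repair.ModelGrowingColumnExp
import Summits.ABC.IUTFork.Repair.CandExplicit5
import HarnessLib

/-!
# IUT REPAIR branch (rung LADDER-ABC:A2.RP ⊆ A2.B), sub-cell B2 — `CandExplicit10` CONCORDANCE with abc-iut-rp-x1's rows, and x1's rows at the
# GROWING-COLUMN bed and family (row RP-X0k, k = 10, Tests companion)

Proof-only file (0 definitions, 0 `Prop` facts) of the abc-iut cell's REPAIR branch (seat abc-iut-rp-x2, gen 2; lead abc-iut-rp-plan). TAKES NO SIDE;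
nothing here asserts abc or [IUTchIII] Cor. 3.12 proved or refuted; candidates are hypotheses; typed ≠ proved; instantiated ≠ endorsed. Imported BY NAME:
this seat's `Repair.CandExplicit10` (p437116: `H` = growth, `H₂` = (Ind3>1+2)), `Repair.ModelGrowingColumnExp` (p437651: the growing-column FAMILY
`growSettingE p e`) and `Repair.ModelGrowingColumn` (p431535); abc-iut-rp-x1's `Repair.CandExplicit1` (p428281: RP-X01a `H_Stp`, RP-X01b `H_Englf`, RP-X03a
`H_DltLb`), `Repair.CandExplicit3` (p429728: RP-X03b `H_coric`, RP-X03c `H_Ind3`), `Repair.CandExplicit5` (p430266: RP-X08 `H_U03`/`H_U04`/`H_U05`).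

§1 CONCORDANCE (ERRATUM for this seat's rows RP-X13/RP-X14, kernel): `CandExplicit10.H` (growth, typed from (CnfInd3)'s last sentence) is EXACTLY the
NEGATION of abc-iut-rp-x1's diagnostic `CandExplicit3.H_coric` ((logORInd) «tautologically vertically coric output», RP-X03b) and of
`CandExplicit5.H_U04` (2024 «symmetrization m ↦ m+1», RP-X08/U-04) — `H_iff_not_coric`, `H_iff_not_U04`; and `CandExplicit10.H₂` ((Ind3>1+2)) is
abc-iut-rp-x1's `CandExplicit3.H_Ind3` (RP-X03c, same sentence, same Step (x) lemma) MINUS its admissibility conjunct — `H₂_of_H_Ind3`,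
`H_Ind3_of_H₂_of_adm`. So RP-X14 is NOT a new row (it restates RP-X03c in weaker form; fold its cells there), and RP-X13 is the negation of RP-X03b /
U-04: what `CandExplicit10` ADDS to those rows is (i) the refutation of the growth at the level of print's m-compatibility clause for (b)
(`Column.MutualCompat`.1 — x1 derived `H_coric`/`H_U04` from the stronger `KummerB`): `coric_of_mutualCompat`, `U04_of_mutualCompat`; (ii) the ∀-form
verdicts `H_contradicts_interface` / `H_contradicts_mutualCompat`; (iii) the growing-column cells below.
§2 abc-iut-rp-x1's rows AT THE GROWING-COLUMN BED (the cells x1 announced for its bounced append p432038, HOME/STATUS 08:56:34Z, re-derived here with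
x1's statements: `H_Stp ✗`, `H_coric ✗`, `H_U04 ✗`, `H_Englf ✓`, `H_DltLb ✗`, `H_Ind3 ✓`, `H_U03 ✓`, `H_U05 ✓`; package `x1_rows_at_growSetting`).
§3 along the FAMILY: growth for every `e` (`H_at_growE`), hence `H_coric`/`H_U04` fail for every `e`; and the packaged verdict `growth_idle` (at
`e = (1, 0)` the growth holds with the pins, the bridge hypotheses and `|log(q)| > 0` while the Statement, RP-X04a, Reading R3 and S all fail).
Interface/toy level; no side taken; typed ≠ proved. [claim: Mochizuki2012, status: disputed]
-/

noncomputable section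

open Set

namespace Summit.ABC.IUTFork.Repair.CandExplicit10

open Thm311 Cor312 Cor312Vol Literature.IUT.LogThetaLattice
open Cor312Vol.PinnedWitness Cor312Vol.NaiveWitness Cor312Vol.PinnedHonest Cor312.Checks Cor312.IdentifiedNonVacuity
open Cor312Vol.GluedMonoids.Naive ModelGrowingColumn ModelGrowingColumnExp

variable {T : ThetaIndex} (S : LatticeSituation T) (P : Cor312.Setting S.toSituation)
  (ρ : (∀ v : T.V, v ∈ T.Vbad → Set (S.L.StarPacket v)) → ∀ (j : T.Label) (vQ : T.VQ), Set (S.L.Packet j vQ))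
  (qK : ∀ v : T.V, v ∈ T.Vbad → Set (S.L.StarPacket v))

/-! ## 1. Concordance with abc-iut-rp-x1's rows -/

/-- **`H` (growth) ⟺ ¬ `CandExplicit3.H_coric`** (abc-iut-rp-x1's RP-X03b diagnostic «the output does not depend on the vertical position»).
[folklore] -/
theorem H_iff_not_coric : H S P ↔ ¬ CandExplicit3.H_coric S P := by
  constructor
  · rintro ⟨j, vQ, m, m', hne⟩ hc
    exact hne (hc m m' j vQ)
  · intro hc
    by_contra hH
    exact hc fun m m' j vQ => (not_H_iff S P).1 hH j vQ m m'

/-- **`H` (growth) ⟺ ¬ `CandExplicit5.H_U04`** (abc-iut-rp-x1's RP-X08 / U-04 «symmetrization m ↦ m+1»; x1's `H_U04_iff_coric`). [folklore] -/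
theorem H_iff_not_U04 : H S P ↔ ¬ CandExplicit5.H_U04 S P := by
  rw [H_iff_not_coric, CandExplicit5.H_U04_iff_coric]

/-- **`CandExplicit3.H_coric` from the Θ-pin + print's m-compatibility clause for (b)** (the first conjunct of `Column.MutualCompat`) — x1's
`H_coric_of_thetaPinned` with `KummerB` weakened. [claim: Mochizuki2012, status: disputed] -/
theorem coric_of_mutualCompat (hΘ : ThetaPinned S P ρ) (hMC : (S.col P.n).MutualCompat) : CandExplicit3.H_coric S P :=
  fun m m' j vQ => by
    rw [thetaRegion_eq_of_thetaPinned_of_translate S P ρ hΘ hMC.1 m j vQ, thetaRegion_eq_of_thetaPinned_of_translate S P ρ hΘ hMC.1 m' j vQ]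

/-- … and likewise `CandExplicit5.H_U04` (x1's `H_U04_of_thetaPinned` with `KummerB` weakened). [claim: Mochizuki2012, status: disputed] -/
theorem U04_of_mutualCompat (hΘ : ThetaPinned S P ρ) (hMC : (S.col P.n).MutualCompat) : CandExplicit5.H_U04 S P :=
  (CandExplicit5.H_U04_iff_coric S P).2 (coric_of_mutualCompat S P ρ hΘ hMC)

/-- **`H₂` is abc-iut-rp-x1's `CandExplicit3.H_Ind3` minus the admissibility conjunct** (RP-X03c, the same sentence (Ind3>1+2)): `H_Ind3 ⟹ H₂`.
ERRATUM for this seat's row RP-X14: not a new row — it restates RP-X03c in weaker form. [folklore] -/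
theorem H₂_of_H_Ind3 (h : CandExplicit3.H_Ind3 S P) : H₂ S P := fun j vQ U hU => (h j vQ U hU).2

/-- Conversely, with admissible possible images `H₂` gives back `CandExplicit3.H_Ind3`. [folklore] -/
theorem H_Ind3_of_H₂_of_adm (hadm : ∀ (j : T.Label) (vQ : T.VQ), ∀ U ∈ P.possibleImages j vQ, (S.D P.n).Adm j vQ U) (h : H₂ S P) :
    CandExplicit3.H_Ind3 S P := fun j vQ U hU => ⟨hadm j vQ U hU, h j vQ U hU⟩

/-! ## 2. abc-iut-rp-x1's rows at the growing-column bed (the cells of x1's bounced append p432038, re-derived) -/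

section Grow

variable (p : ℕ) [hp : Fact p.Prime]

/-- **RP-X03b at GROW: `H_coric` FAILS** (the column grows). [folklore] -/
theorem H_coric_not_at_growSetting : ¬ CandExplicit3.H_coric (growFull p).toLatticeSituation (growSetting p) :=
  (H_iff_not_coric _ _).1 (H_at_grow p)

/-- **RP-X08 / U-04 at GROW: `H_U04` FAILS.** [folklore] -/
theorem H_U04_not_at_growSetting : ¬ CandExplicit5.H_U04 (growFull p).toLatticeSituation (growSetting p) :=
  (H_iff_not_U04 _ _).1 (H_at_grow p)

/-- **RP-X01a at GROW: `H_Stp` FAILS** — its first clause puts the CORIC Θ-region `ρ Ψ_n = B_{j²}` among the possible images, which at the bed are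
`{B_{𝟙_j}}` (`B_4 ∉ {B_1}` at label 2): the «diagnostic» row is the (ii)(b)-collapse in disguise and fails exactly where `KummerB` fails. [folklore] -/
theorem H_Stp_not_at_growSetting : ¬ CandExplicit1.H_Stp (growFull p).toLatticeSituation (growSetting p) (ballOfMonoid p) := by
  intro h
  have h2 := h.1 2 ()
  rw [grow_possibleImages, Set.mem_singleton_iff,
    show ((growFull p).toLatticeSituation.D (growSetting p).n).Ψ = fun v _ => Psi p v from rfl, ballOfMonoid_psi,
    show jsq (2 : toyIndex.Label) = 4 by decide, expAt_of_ne_zero oneExp (by decide : (2 : toyIndex.Label) ≠ 0)] at h2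
  have := pBall_injective p 2 () h2
  simp [oneExp] at this

/-- **RP-X01b at GROW: `H_Englf` HOLDS** (the q-region `B_1` lies in the hull `B_1`; with Reading R3 and the Statement, `grow_profile`). [folklore] -/
theorem H_Englf_at_growSetting : CandExplicit1.H_Englf (growFull p).toLatticeSituation (growSetting p) (ballOfMonoid p) (qOne p) :=
  (CandExplicit1.H_Englf_iff _ _ (ballOfMonoid p) (qOne p) (grow_linkPinned p)).2
    (CandExplicit4.hull_of_H _ _ (ballOfMonoid p) (qOne p) (grow_qPinned p) (grow_H p))

/-- **RP-X03a at GROW: `H_DltLb` FAILS** — under the three pins it gives S (x1's `S_of_H_DltLb`), and S fails at the bed. [folklore] -/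
theorem H_DltLb_not_at_growSetting : ¬ CandExplicit1.H_DltLb (growFull p).toLatticeSituation (growSetting p) (ballOfMonoid p) (qOne p) :=
  fun h => grow_not_S p (CandExplicit1.S_of_H_DltLb _ _ _ _ (grow_pinnedRegions3 p) h)

/-- **RP-X03c / RP-X08 (U-03, U-05) at GROW: `H_Ind3`, `H_U03`, `H_U05` HOLD** (Step (x) holds for the coric data, `grow_honesty`; `H_U03`'s conclusion
`¬ S` is true at the bed; `H_U05` = `LogvolPrecise`, `grow_logvolPrecise`). [folklore] -/
theorem ind3_u03_u05_at_growSetting :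
    CandExplicit3.H_Ind3 (growFull p).toLatticeSituation (growSetting p) ∧
      CandExplicit5.H_U03 (growFull p).toLatticeSituation (growSetting p) (ballOfMonoid p) (qOne p) ∧
      CandExplicit5.H_U05 (growFull p).toLatticeSituation (growSetting p) :=
  ⟨CandExplicit3.H_Ind3_of_stepX _ _ (grow_honesty p).1 (grow_honesty p).2.1 (grow_honesty p).2.2.1,
    fun _ _ _ _ _ _ _ _ => grow_not_S p, grow_logvolPrecise p _⟩

/-- **x1's rows at GROW, packaged** (PROFILE cell «GROW» for RP-X01a/b, RP-X03a/b/c, RP-X08; the statement abc-iut-rp-x1 announced for p432038): the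
three pins hold and (ii)(b) fails; `H_Stp`, `H_coric`, `H_U04` FAIL (the (ii)(b)-collapse in disguise); `H_Englf` HOLDS (with Reading R3 and the
Statement); `H_DltLb` FAILS (with S); `H_Ind3`, `H_U03`, `H_U05` HOLD. [folklore] -/
theorem x1_rows_at_growSetting :
    PinnedRegions3 (growFull p).toLatticeSituation (growSetting p) (ballOfMonoid p) (qOne p) ∧
      ¬ ((growFull p).toLatticeSituation.col 0).KummerB ((growFull p).toLatticeSituation.D 0) ∧
      ¬ CandExplicit1.H_Stp (growFull p).toLatticeSituation (growSetting p) (ballOfMonoid p) ∧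
      CandExplicit1.H_Englf (growFull p).toLatticeSituation (growSetting p) (ballOfMonoid p) (qOne p) ∧
      ¬ CandExplicit1.H_DltLb (growFull p).toLatticeSituation (growSetting p) (ballOfMonoid p) (qOne p) ∧
      ¬ CandExplicit3.H_coric (growFull p).toLatticeSituation (growSetting p) ∧
      (CandExplicit3.H_Ind3 (growFull p).toLatticeSituation (growSetting p) ∧
        CandExplicit5.H_U03 (growFull p).toLatticeSituation (growSetting p) (ballOfMonoid p) (qOne p) ∧
        CandExplicit5.H_U05 (growFull p).toLatticeSituation (growSetting p)) ∧
      ¬ CandExplicit5.H_U04 (growFull p).toLatticeSituation (growSetting p) ∧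
      (∀ (j : toyIndex.Label) (vQ : toyIndex.VQ), (growSetting p).qRegion j vQ ∈ (growSetting p).possibleImages j vQ) ∧
      (growSetting p).Statement ∧
      ¬ PilotKummerIndRelated (growFull p).toLatticeSituation (growSetting p) (ballOfMonoid p) (qOne p) :=
  ⟨grow_pinnedRegions3 p, grow_not_kummerB p 0, H_Stp_not_at_growSetting p, H_Englf_at_growSetting p, H_DltLb_not_at_growSetting p,
    H_coric_not_at_growSetting p, ind3_u03_u05_at_growSetting p, H_U04_not_at_growSetting p, grow_reading3 p, (grow_statement p).1,
    grow_not_S p⟩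

/-! ## 3. Along the growing-column family -/

/-- **`H` HOLDS at every member of the family** (the column is the growing one for every q-datum exponent `e`). [folklore] -/
theorem H_at_growE (e : toyIndex.LabelStar → ℕ) : H (growFull p).toLatticeSituation (growSettingE p e) := ⟨2, (), 0, 1, growE_growth p e⟩

/-- … hence x1's `H_coric` and `H_U04` FAIL at every member. [folklore] -/
theorem coric_U04_not_at_growE (e : toyIndex.LabelStar → ℕ) :
    ¬ CandExplicit3.H_coric (growFull p).toLatticeSituation (growSettingE p e) ∧ ¬ CandExplicit5.H_U04 (growFull p).toLatticeSituation (growSettingE p e) :=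
  ⟨(H_iff_not_coric _ _).1 (H_at_growE p e), (H_iff_not_U04 _ _).1 (H_at_growE p e)⟩

/-- **`growth_idle` — THE GROWTH BY ITSELF SUPPLIES NOTHING** (row RP-X13, T-c/T-b cell at the member `e = (1, 0)` of the family,
`ModelGrowingColumnExp.idle_point`): `H` ∧ three pins ∧ bridge hypotheses ∧ `|log(q)| > 0` hold while the typed Statement, RP-X04a's containment,
print's Reading R3 and the residual S ALL FAIL. What carried the Statement at the landed bed is the q-datum's position relative to the grown union
(RP-X04a/b), not the growth. [folklore] -/
theorem growth_idle :
    H (growFull p).toLatticeSituation (growSettingE p (vec 1 0)) ∧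
      PinnedRegions3 (growFull p).toLatticeSituation (growSettingE p (vec 1 0)) (ballOfMonoid p) (qE p (vec 1 0)) ∧
      BridgeHyps (growSettingE p (vec 1 0)) ∧ (growSettingE p (vec 1 0)).AbsLogQPos ∧
      ¬ (growSettingE p (vec 1 0)).Statement ∧ ¬ CandExplicit4.H (growFull p).toLatticeSituation (growSettingE p (vec 1 0)) ∧
      ¬ (∀ (j : toyIndex.Label) (vQ : toyIndex.VQ), (growSettingE p (vec 1 0)).qRegion j vQ ∈ (growSettingE p (vec 1 0)).possibleImages j vQ) ∧
      ¬ PilotKummerIndRelated (growFull p).toLatticeSituation (growSettingE p (vec 1 0)) (ballOfMonoid p) (qE p (vec 1 0)) :=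
  ⟨H_at_growE p _, (idle_point p).2.2.1, (idle_point p).2.2.2.1, (idle_point p).2.2.2.2.1, (idle_point p).2.2.2.2.2.1, (idle_point p).2.2.2.2.2.2.1,
    (idle_point p).2.2.2.2.2.2.2.1, (idle_point p).2.2.2.2.2.2.2.2⟩

end Grow

/-- **T-a FAIL for `H` at every target, ∃-form (`H_not_imp_targets`)**: there is a pinned setting with bridge hypotheses and `|log(q)| > 0` where `H`
holds and the Statement, the (xi-f) Licence-level containment RP-X04a, Reading R3 and S all fail — so no derivation «pins + bridge hypotheses +
`|log(q)| > 0` + `H` ⟹ target» exists WITHOUT the clause `H` contradicts ((ii)(b)'s m-compatibility); with it, every such derivation is vacuous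
(`S_of_H_vacuous`). [folklore] -/
theorem H_not_imp_targets :
    ∃ (T : ThetaIndex) (F : FullSituation T) (P : Cor312.Setting F.toLatticeSituation.toSituation)
      (ρ : (∀ v : T.V, v ∈ T.Vbad → Set (F.L.StarPacket v)) → ∀ (j : T.Label) (vQ : T.VQ), Set (F.L.Packet j vQ))
      (qK : ∀ v : T.V, v ∈ T.Vbad → Set (F.L.StarPacket v)),
      H F.toLatticeSituation P ∧ PinnedRegions3 F.toLatticeSituation P ρ qK ∧ BridgeHyps P ∧ P.AbsLogQPos ∧
        ¬ P.Statement ∧ ¬ CandExplicit4.H F.toLatticeSituation P ∧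
        ¬ (∀ (j : T.Label) (vQ : T.VQ), P.qRegion j vQ ∈ P.possibleImages j vQ) ∧
        ¬ PilotKummerIndRelated F.toLatticeSituation P ρ qK := by
  haveI : Fact (Nat.Prime 2) := ⟨Nat.prime_two⟩
  exact ⟨toyIndex, growFull 2, growSettingE 2 (vec 1 0), ballOfMonoid 2, qE 2 (vec 1 0), growth_idle 2⟩

end Summit.ABC.IUTFork.Repair.CandExplicit10

end
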